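import Literature.ModelTheory.ExponentialFields.OMinimalDimensionFibres
import Literature.ModelTheory.ExponentialFields.OMinimalConnectedComponents
import HarnessLib

/-!
# Frontiers and sets with empty interior in o-minimal structures (van den Dries, Ch. 4, (1.3), (1.10))

Topic `Literature/ModelTheory/ExponentialFields`, continuing `OMinimalDimension.lean` (van den Dries
1998, Ch. 4, §1) for an arbitrary o-minimal structure on a dense linear order without endpoints with
its order topology (`<` definable), the setting of `OMinimalCellDecomposition.lean`.

Printed source: Ch. 4 (1.1) "`dim X = m` iff `X` contains an open cell"; (1.3)(iii)
"`dim(X ∪ Y) = max{dim X, dim Y}`" (`CellDimension.dim_union` in the tree); and the use made of them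
in Ch. 8 (2.9) (p. 130): "`T := bd(S) ∪ bd(S₁) ∪ ⋯ ∪ bd(S_k)`, so `dim(T) < m + 1` by Chapter 4,
(1.10)". What the triangulation induction needs is exactly that such a `T` has EMPTY INTERIOR, and
this follows from (1.1) + (1.3)(iii) alone, without the frontier inequality (1.8)/(1.10) for
dimensions: the interior `U` of `bd(S)` would be an open set split into the two definable sets
`U ∩ S` and `U ∖ S`, both with empty interior, hence both of dimension `< m`, contradicting
`dim U = m`.

## Main statements (all proved)

* `definable_interior`, `definable_frontier` — interior and frontier of definable sets are
  definable (from the tree's `definable_closure`).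
* `CellDimension.dim_lt_of_interior_eq_empty` — a non-empty definable set
  with empty interior has dimension `< m`; `CellDimension.interior_eq_empty_of_dim_lt`.
* `interior_union_eq_empty_of_definable`, `interior_biUnion_eq_empty_of_definable` — finite unions of
  definable sets with empty interior have empty interior.
* `interior_frontier_eq_empty_of_definable` — **the frontier of a definable set has empty
  interior** (for closed sets this is Mathlib's `interior_frontier`; here for every definable set).
* `interior_closure_eq_empty_of_definable` — a definable set with empty interior is nowhere dense.

## References

* [Dries1998] L. van den Dries, *Tame topology and o-minimal structures* (1998), Ch. 4 (1.1),
  (1.3), (1.10); Ch. 8 (2.9), p. 130 (read in the held copy).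
-/

open Set FirstOrder FirstOrder.Language
open _root_.Filter _root_.Topology

namespace Literature.ModelTheory.ExponentialFields

universe u v

variable {L : FirstOrder.Language.{u, v}} {M : Type*} [L.Structure M] [LinearOrder M]
  [TopologicalSpace M] {m : ℕ}

/-! ### Interior and frontier are definable -/

/-- **Interiors of definable sets are definable** (complement of the closure of the complement).
[cite: Dries1998, Ch. 1 (3.4)] -/
theorem definable_interior [OrderTopology M] [NoMinOrder M] [NoMaxOrder M]
    (hlt : (univ : Set M).Definable L {v : Fin 2 → M | v 0 < v 1})
    {Y : Set (Fin m → M)} (hY : (univ : Set M).Definable L Y) :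
    (univ : Set M).Definable L (interior Y) := by
  rw [interior_eq_compl_closure_compl]
  exact (definable_closure hlt hY.compl).compl

/-- **Frontiers of definable sets are definable** (`bd Y = cl Y ∩ cl Yᶜ`). [cite: Dries1998, Ch. 1 (3.4)] -/
theorem definable_frontier [OrderTopology M] [NoMinOrder M] [NoMaxOrder M]
    (hlt : (univ : Set M).Definable L {v : Fin 2 → M | v 0 < v 1})
    {Y : Set (Fin m → M)} (hY : (univ : Set M).Definable L Y) :
    (univ : Set M).Definable L (frontier Y) := by
  rw [frontier_eq_closure_inter_closure]
  exact (definable_closure hlt hY).inter (definable_closure hlt hY.compl)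

namespace CellDimension

section OMinimal

variable [DenselyOrdered M] [NoMinOrder M] [NoMaxOrder M] [Nonempty M] [OrderTopology M]

/-- **A non-empty definable set with empty interior has dimension `< m`** ((1.1): `dim X = m` iff
`X` contains an open cell). [cite: Dries1998, Ch. 4 (1.1)] -/
theorem dim_lt_of_interior_eq_empty (hO : L.IsOMinimal M)
    (hlt : (univ : Set M).Definable L {v : Fin 2 → M | v 0 < v 1})
    {X : Set (Fin m → M)} (hX : (univ : Set M).Definable L X) (hne : X.Nonempty)
    (hint : interior X = ∅) : dim L m X < m := by
  refine lt_of_le_of_ne (dim_le X) fun hdim => ?_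
  obtain ⟨x, hx⟩ := interior_nonempty_of_dim_eq hO hlt hX hne hdim
  rw [hint] at hx
  exact hx

omit [DenselyOrdered M] [Nonempty M] in
/-- A set of dimension `< m` has empty interior. [cite: Dries1998, Ch. 4 (1.1)] -/
theorem interior_eq_empty_of_dim_lt
    (hlt : (univ : Set M).Definable L {v : Fin 2 → M | v 0 < v 1})
    {X : Set (Fin m → M)} (hdim : dim L m X < m) : interior X = ∅ := by
  by_contra hne
  have h := dim_eq_of_interior_nonempty (L := L) hlt (nonempty_iff_ne_empty.2 hne)
  omega

/-- **Finite unions of definable sets with empty interior have empty interior** — via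
(1.3)(iii) `dim(X ∪ Y) = max(dim X, dim Y)` (the sets themselves need not be closed).
[cite: Dries1998, Ch. 4 (1.3)(iii)] -/
theorem interior_union_eq_empty_of_definable (hO : L.IsOMinimal M)
    (hlt : (univ : Set M).Definable L {v : Fin 2 → M | v 0 < v 1})
    {X Y : Set (Fin m → M)} (hX : (univ : Set M).Definable L X)
    (hY : (univ : Set M).Definable L Y) (hXi : interior X = ∅) (hYi : interior Y = ∅) :
    interior (X ∪ Y) = ∅ := by
  -- dispose of the empty pieces
  rcases X.eq_empty_or_nonempty with rfl | hXne
  · simpa using hYi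
  rcases Y.eq_empty_or_nonempty with rfl | hYne
  · simpa using hXi
  have hdX := dim_lt_of_interior_eq_empty hO hlt hX hXne hXi
  have hdY := dim_lt_of_interior_eq_empty hO hlt hY hYne hYi
  refine interior_eq_empty_of_dim_lt hlt ?_
  rw [dim_union hO hlt hX hY]
  exact max_lt hdX hdY

omit [LinearOrder M] [TopologicalSpace M] [DenselyOrdered M] [NoMinOrder M] [NoMaxOrder M]
  [Nonempty M] [OrderTopology M] in
/-- Finite unions over a `Finset` of sets each of which is definable (hypothesis only on the
members). [folklore] -/
theorem definable_biUnion_finset_mem {β γ : Type*} {s : Finset β} {t : β → Set (γ → M)}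
    (ht : ∀ i ∈ s, (univ : Set M).Definable L (t i)) :
    (univ : Set M).Definable L (⋃ i ∈ s, t i) := by
  classical
  induction s using Finset.induction_on with
  | empty => simp
  | insert a s ha ih =>
    rw [Finset.set_biUnion_insert]
    exact (ht a (Finset.mem_insert_self a s)).union
      (ih fun i hi => ht i (Finset.mem_insert_of_mem hi))

/-- Finite unions over a `Finset` of definable sets with empty interior have empty interior.
[cite: Dries1998, Ch. 4 (1.3)(iii)] -/
theorem interior_biUnion_eq_empty_of_definable (hO : L.IsOMinimal M)
    (hlt : (univ : Set M).Definable L {v : Fin 2 → M | v 0 < v 1}) {β : Type*} (I : Finset β)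
    {Z : β → Set (Fin m → M)} (hZ : ∀ i ∈ I, (univ : Set M).Definable L (Z i))
    (hZi : ∀ i ∈ I, interior (Z i) = ∅) : interior (⋃ i ∈ I, Z i) = ∅ := by
  classical
  induction I using Finset.induction_on with
  | empty => simp
  | insert a s ha ih =>
    rw [Finset.set_biUnion_insert]
    exact interior_union_eq_empty_of_definable hO hlt (hZ a (Finset.mem_insert_self a s))
      (definable_biUnion_finset_mem fun i hi => hZ i (Finset.mem_insert_of_mem hi))
      (hZi a (Finset.mem_insert_self a s))
      (ih (fun i hi => hZ i (Finset.mem_insert_of_mem hi))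
        (fun i hi => hZi i (Finset.mem_insert_of_mem hi)))

/-- **The frontier of a definable set has empty interior.** (For closed sets this is general
topology, Mathlib's `interior_frontier`; for an arbitrary definable `S` it is o-minimality: the
interior `U` of `bd S` splits into the definable sets `U ∩ S` and `U ∖ S`, both with empty interior
because `U` misses `int S` and lies inside `cl S`, so both have dimension `< m` while `dim U = m`.)
This is the form in which "`dim(bd S) < m`" (van den Dries 1998, Ch. 4 (1.10)) enters the
triangulation theorem, Ch. 8 (2.9). [cite: Dries1998, Ch. 4 (1.10)] -/
theorem interior_frontier_eq_empty_of_definable (hO : L.IsOMinimal M)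
    (hlt : (univ : Set M).Definable L {v : Fin 2 → M | v 0 < v 1})
    {S : Set (Fin m → M)} (hS : (univ : Set M).Definable L S) :
    interior (frontier S) = ∅ := by
  set U : Set (Fin m → M) := interior (frontier S) with hU
  have hUdef : (univ : Set M).Definable L U := definable_interior hlt (definable_frontier hlt hS)
  have hUfr : U ⊆ frontier S := interior_subset
  -- the two pieces
  have hX : interior (U ∩ S) = ∅ := by
    refine eq_empty_iff_forall_notMem.2 fun x hx => ?_
    have hxS : x ∈ interior S := interior_mono inter_subset_right hx
    have hxU : x ∈ U := interior_subset hx |>.1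
    have hfr := hUfr hxU
    rw [frontier, Set.mem_sdiff] at hfr
    exact hfr.2 hxS
  have hY : interior (U ∩ Sᶜ) = ∅ := by
    refine eq_empty_iff_forall_notMem.2 fun x hx => ?_
    have hxS : x ∈ interior Sᶜ := interior_mono inter_subset_right hx
    have hxU : x ∈ U := interior_subset hx |>.1
    have hfr := hUfr hxU
    rw [frontier, Set.mem_sdiff] at hfr
    rw [interior_compl] at hxS
    exact hxS hfr.1
  have hUnion : U = (U ∩ S) ∪ (U ∩ Sᶜ) := by
    rw [← inter_union_distrib_left, union_compl_self, inter_univ]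
  have hUi : interior U = ∅ := by
    rw [hUnion]
    exact interior_union_eq_empty_of_definable hO hlt (hUdef.inter hS) (hUdef.inter hS.compl) hX hY
  -- but `U` is open
  have hUo : IsOpen U := isOpen_interior
  rw [hUo.interior_eq] at hUi
  exact hUi

/-- **A definable set with empty interior is nowhere dense**: its closure has empty interior
(`cl S = S ∪ bd S`, and an open box inside `cl S` missing `int S = ∅` lies in `bd S`).
[cite: Dries1998, Ch. 4 (1.10)] -/
theorem interior_closure_eq_empty_of_definable (hO : L.IsOMinimal M)
    (hlt : (univ : Set M).Definable L {v : Fin 2 → M | v 0 < v 1})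
    {S : Set (Fin m → M)} (hS : (univ : Set M).Definable L S) (hint : interior S = ∅) :
    interior (closure S) = ∅ := by
  have h : closure S = frontier S := by
    rw [frontier, hint, Set.sdiff_empty]
  rw [h]
  exact interior_frontier_eq_empty_of_definable hO hlt hS

end OMinimal

end CellDimension

end Literature.ModelTheory.ExponentialFields
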